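import Summits.HubbardSuperconductivity.HubbardSuperconductivity.Theorems.DeformationLadderLowEnergyRigidityTelescopeDefs
import Literature.MathematicalPhysics.QuantumLattice.PairFieldMomentum

/-!
# Telescope rigidity, part 2: infrared pair-momentum phases are nearly constant on cells

Route `DeformationLadder`, crux `LowEnergyRigidity` (item stmt-HubbardSuperconductivity-1892), line
`Sketch` (poincare-telescope). Support file (elementary torus arithmetic, no definitions):

* `rig_window_rep`: a momentum component `a ∈ ℤ/L` in the infrared window
  `min (a.val) (L − a.val) ≤ K` has a signed representative `κ ∈ ℤ`, `|κ| ≤ K`, `a.val = κ + L t`;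
* `rig_cellIndex_val`, `rig_cell_frac_bounds`: the cell index `q = ⌊x·k/L⌋` of a coordinate satisfies
  `q/k ≤ x/L < (q+1)/k`;
* `rig_norm_phase_sub_cellPhase_le`: for a window momentum `k₀` (signed representatives `κ`) and the
  cell phase `c_b = conj χ_κ̄(b)` of the CELL torus `(ℤ/kℤ)²` (`κ̄ = κ mod k`), the pair-momentum phase
  `e_x = exp(−2πi k₀·x/L)` of `TwistGap.TgPairMomentumRigidity` satisfies `‖e_x − c_{cellOf x}‖ ≤ 4πK/k`;
* `rig_sum_cellPhase_eq_zero`: `Σ_b c_b = 0` as soon as `κ̄ ≠ 0` (character orthogonality), which holds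
  when `k₀ ≠ 0` and `K < k` (`rig_cellMomentum_ne_zero`);
* `rig_card_window_le`: the window has at most `(2K+1)²` momenta.
[folklore]
-/

noncomputable section

namespace Summit.HubbardSuperconductivity.HubbardSuperconductivity.Theorems.LowEnergyRigidity.Telescope

set_option linter.dupNamespace false -- summit = problem name (single-conjunct summit), D-0017

open Matrix Complex Finset Literature.MathematicalPhysics.QuantumLattice Literature.Probability.LatticeModels
open scoped ComplexConjugate ComplexOrder

/-! ### Unit complex numbers -/

/-- `‖e^{iα} − e^{iβ}‖ ≤ |α − β − 2πz|` for every integer `z`. [folklore] -/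
theorem rig_norm_exp_I_sub_exp_I_le (α β : ℝ) (z : ℤ) :
    ‖Complex.exp (Complex.I * α) - Complex.exp (Complex.I * β)‖ ≤ |α - β - 2 * Real.pi * z| := by
  have h1 : Complex.exp (Complex.I * α) =
      Complex.exp (Complex.I * β) * Complex.exp (Complex.I * ((α - β - 2 * Real.pi * z : ℝ) : ℂ)) := by
    rw [← Complex.exp_add, Complex.exp_eq_exp_iff_exists_int]
    exact ⟨z, by push_cast; ring⟩
  have h2 : Complex.exp (Complex.I * α) - Complex.exp (Complex.I * β) =
      Complex.exp (Complex.I * β) * (Complex.exp (Complex.I * ((α - β - 2 * Real.pi * z : ℝ) : ℂ)) - 1) := by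
    rw [mul_sub, mul_one, ← h1]
  rw [h2, norm_mul, mul_comm Complex.I (β : ℂ), Complex.norm_exp_ofReal_mul_I, one_mul]
  exact (Real.norm_exp_I_mul_ofReal_sub_one_le).trans (le_of_eq (Real.norm_eq_abs _))

/-! ### The infrared window: signed representatives and cardinality -/

/-- A window component `a ∈ ℤ/L` with `min a.val (L − a.val) ≤ K` has a signed representative
`κ ∈ [−K, K]` with `a.val = κ + L·t` (`t ∈ {0, 1}`), nonzero when `a ≠ 0`. [folklore] -/
theorem rig_window_rep {L : ℕ} [NeZero L] {K : ℕ} (a : ZMod L) (ha : min a.val (L - a.val) ≤ K) :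
    ∃ κ t : ℤ, |κ| ≤ K ∧ ((a.val : ℤ) = κ + (L : ℤ) * t) ∧ (a ≠ 0 → κ ≠ 0) := by
  have hlt : a.val < L := ZMod.val_lt a
  rcases le_or_gt a.val K with h | h
  · refine ⟨(a.val : ℤ), 0, ?_, by ring, ?_⟩
    · rw [Nat.abs_cast]; exact_mod_cast h
    · intro ha0 h0
      exact ha0 ((ZMod.val_eq_zero a).mp (by exact_mod_cast h0))
  · have h2 : L - a.val ≤ K := by
      rcases min_le_iff.mp ha with h' | h'
      · exact absurd h' (not_le.mpr h)
      · exact h'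
    refine ⟨(a.val : ℤ) - L, 1, ?_, by ring, ?_⟩
    · rw [abs_le]
      constructor
      · have : ((L - a.val : ℕ) : ℤ) ≤ K := by exact_mod_cast h2
        rw [Nat.cast_sub hlt.le] at this
        linarith
      · have : (a.val : ℤ) < L := by exact_mod_cast hlt
        linarith
    · intro _ h0
      have : (a.val : ℤ) < L := by exact_mod_cast hlt
      linarith

/-- The one-dimensional window `{a ∈ ℤ/L : min a.val (L − a.val) ≤ K}` has at most `2K+1` elements. [folklore] -/
theorem rig_card_window_one_le (L : ℕ) [NeZero L] (K : ℕ) :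
    (Finset.univ.filter (fun a : ZMod L => min a.val (L - a.val) ≤ K)).card ≤ 2 * K + 1 := by
  classical
  set S := Finset.univ.filter (fun a : ZMod L => min a.val (L - a.val) ≤ K) with hS
  set T : Finset ℕ := Finset.range (K + 1) ∪ Finset.Ico (L - K) L with hT
  have hmap : ∀ a ∈ S, a.val ∈ T := by
    intro a ha
    rw [hS, Finset.mem_filter] at ha
    have hlt : a.val < L := ZMod.val_lt a
    rw [hT, Finset.mem_union, Finset.mem_range, Finset.mem_Ico]
    rcases min_le_iff.mp ha.2 with h | h
    · left; omega
    · right; omega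
  have hinj : Set.InjOn (fun a : ZMod L => a.val) S := fun a _ b _ h => ZMod.val_injective L h
  calc S.card ≤ T.card := Finset.card_le_card_of_injOn _ hmap hinj
    _ ≤ (Finset.range (K + 1)).card + (Finset.Ico (L - K) L).card := Finset.card_union_le _ _
    _ ≤ 2 * K + 1 := by
        rw [Finset.card_range, Nat.card_Ico]
        omega

/-- **The infrared window has at most `(2K+1)²` momenta** (and a fortiori so does the window with
`0` removed). [folklore] -/
theorem rig_card_window_le (L : ℕ) [NeZero L] (K : ℕ) :
    (Finset.univ.filter (fun k : TorusSite 2 L => k ≠ 0 ∧ ∀ i : Fin 2, min (k i).val (L - (k i).val) ≤ K)).card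
      ≤ (2 * K + 1) ^ 2 := by
  classical
  set S := Finset.univ.filter (fun a : ZMod L => min a.val (L - a.val) ≤ K) with hS
  have hsub : Finset.univ.filter (fun k : TorusSite 2 L => k ≠ 0 ∧ ∀ i : Fin 2, min (k i).val (L - (k i).val) ≤ K)
      ⊆ Fintype.piFinset (fun _ : Fin 2 => S) := by
    intro k hk
    rw [Finset.mem_filter] at hk
    rw [Fintype.mem_piFinset]
    intro i
    rw [hS, Finset.mem_filter]
    exact ⟨Finset.mem_univ _, hk.2.2 i⟩
  refine (Finset.card_le_card hsub).trans ?_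
  rw [Fintype.card_piFinset, Finset.prod_const, Finset.card_univ, Fintype.card_fin]
  exact Nat.pow_le_pow_left (rig_card_window_one_le L K) 2

/-! ### Cells of a coordinate -/

/-- The cell index of a coordinate `x ∈ ℤ/L` at cell count `k ≥ 1` has representative
`⌊x.val·k/L⌋ < k`. [folklore] -/
theorem rig_cellIndex_val {L : ℕ} [NeZero L] {k : ℕ} [NeZero k] (x : ZMod L) :
    (cellIndex L k x).val = x.val * k / L := by
  have hL : 0 < L := Nat.pos_of_ne_zero (NeZero.ne L)
  have hlt : x.val * k / L < k := by
    rw [Nat.div_lt_iff_lt_mul hL, mul_comm k L]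
    exact mul_lt_mul_of_pos_right (ZMod.val_lt x) (Nat.pos_of_ne_zero (NeZero.ne k))
  unfold cellIndex
  exact ZMod.val_cast_of_lt hlt

/-- **Cell fraction bounds**: with `q = (cellIndex L k x).val`, `q/k ≤ x.val/L < (q+1)/k`; hence
`0 ≤ x.val/L − q/k ≤ 1/k`. [folklore] -/
theorem rig_cell_frac_bounds {L : ℕ} [NeZero L] {k : ℕ} [NeZero k] (x : ZMod L) :
    0 ≤ (x.val : ℝ) / L - ((cellIndex L k x).val : ℝ) / k ∧
      (x.val : ℝ) / L - ((cellIndex L k x).val : ℝ) / k ≤ 1 / k := by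
  have hL : (0 : ℝ) < L := Nat.cast_pos.mpr (Nat.pos_of_ne_zero (NeZero.ne L))
  have hk : (0 : ℝ) < k := Nat.cast_pos.mpr (Nat.pos_of_ne_zero (NeZero.ne k))
  have hLn : 0 < L := Nat.pos_of_ne_zero (NeZero.ne L)
  rw [rig_cellIndex_val]
  set q := x.val * k / L with hq
  have h1 : q * L ≤ x.val * k := Nat.div_mul_le_self _ _
  have h2 : x.val * k < q * L + L := Nat.lt_div_mul_add hLn
  have h1r : (q : ℝ) * L ≤ (x.val : ℝ) * k := by exact_mod_cast h1
  have h2r : (x.val : ℝ) * k ≤ (q : ℝ) * L + L := by exact_mod_cast h2.le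
  constructor
  · rw [sub_nonneg, div_le_div_iff₀ hk hL]
    linarith
  · rw [sub_le_iff_le_add, ← add_div, div_le_div_iff₀ hL hk]
    linarith

/-! ### The pair-momentum phase and the cell phases -/

/-- The pair-momentum phase of `TwistGap.TgPairMomentumRigidity` in the form `e^{iα}` with the real
phase `α = −(2π/L) Σᵢ (k₀ i).val (x i).val`. [folklore] -/
theorem rig_phase_eq_exp (L : ℕ) [NeZero L] (k₀ x : TorusSite 2 L) :
    Complex.exp (-(2 * (Real.pi : ℂ) * Complex.I / (L : ℂ)) * ((∑ i : Fin 2, (k₀ i).val * (x i).val : ℕ) : ℂ)) =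
      Complex.exp (Complex.I * ((-(2 * Real.pi / L) * ∑ i : Fin 2, ((k₀ i).val : ℝ) * ((x i).val : ℝ) : ℝ) : ℂ)) := by
  congr 1
  push_cast
  ring

/-- The cell phase `conj χ_κ̄(b)` of the cell torus `(ℤ/kℤ)²` in the form `e^{iβ}`,
`β = −(2π/k) Σᵢ (κ̄ i).val (b i).val`. [folklore] -/
theorem rig_cellPhase_eq_exp (k : ℕ) [NeZero k] (κb b : TorusSite 2 k) :
    conj (torusChar κb b) =
      Complex.exp (Complex.I * ((-(2 * Real.pi / k) * ∑ i : Fin 2, ((κb i).val : ℝ) * ((b i).val : ℝ) : ℝ) : ℂ)) := by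
  unfold torusChar
  simp_rw [stdAddChar_mul_eq_exp]
  rw [← Complex.exp_sum, ← Complex.exp_conj, map_sum]
  congr 1
  push_cast
  simp only [Finset.mul_sum]
  refine Finset.sum_congr rfl fun i _ => ?_
  simp only [map_div₀, map_mul, map_ofNat, Complex.conj_ofReal, Complex.conj_I, map_natCast]
  ring

/-- **Cell phases sum to zero**: `Σ_b conj χ_κ̄(b) = 0` for `κ̄ ≠ 0` (orthogonality of the characters of
`(ℤ/kℤ)²`). [folklore] -/
theorem rig_sum_cellPhase_eq_zero (k : ℕ) [NeZero k] {κb : TorusSite 2 k} (hκ : κb ≠ 0) :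
    ∑ b : TorusSite 2 k, conj (torusChar κb b) = 0 := by
  rw [← map_sum, sum_torusChar_right, if_neg hκ, map_zero]

/-- The reduction `κ̄ = κ mod k` of a nonzero integer vector with `|κᵢ| ≤ K < k` is nonzero in `(ℤ/kℤ)²`. [folklore] -/
theorem rig_cellMomentum_ne_zero {k K : ℕ} [NeZero k] (hKk : K < k) (κ : Fin 2 → ℤ)
    (hκK : ∀ i, |κ i| ≤ K) (hκ0 : ∃ i, κ i ≠ 0) :
    (fun i => ((κ i : ℤ) : ZMod k)) ≠ (0 : TorusSite 2 k) := by
  obtain ⟨i, hi⟩ := hκ0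
  intro h
  have hi0 : ((κ i : ℤ) : ZMod k) = 0 := congrFun h i
  rw [ZMod.intCast_zmod_eq_zero_iff_dvd] at hi0
  have habs : |κ i| < k := lt_of_le_of_lt (by exact_mod_cast hκK i) (by exact_mod_cast hKk)
  exact hi (Int.eq_zero_of_abs_lt_dvd hi0 habs)

/-- **The pair-momentum phase is nearly constant on cells.** Let `k₀ ∈ (ℤ/L)²` have signed
representatives `κᵢ`, `|κᵢ| ≤ K`, `(k₀ i).val = κᵢ + L tᵢ`, and let `κ̄ = κ mod k` on the cell torus
`(ℤ/kℤ)²` (`k ≥ 1`). Then for every site `x`, with `b = cellOf L k x`,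
`‖e^{−2πi k₀·x/L} − conj χ_κ̄(b)‖ ≤ 4πK/k`. [folklore] -/
theorem rig_norm_phase_sub_cellPhase_le (L : ℕ) [NeZero L] (k : ℕ) [NeZero k] (K : ℕ)
    (k₀ : TorusSite 2 L) (κ t : Fin 2 → ℤ) (hκK : ∀ i, |κ i| ≤ K)
    (hrep : ∀ i, (((k₀ i).val : ℕ) : ℤ) = κ i + (L : ℤ) * t i) (x : TorusSite 2 L) :
    ‖Complex.exp (-(2 * (Real.pi : ℂ) * Complex.I / (L : ℂ)) * ((∑ i : Fin 2, (k₀ i).val * (x i).val : ℕ) : ℂ)) -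
        conj (torusChar (fun i => ((κ i : ℤ) : ZMod k)) (cellOf L k x))‖ ≤ 4 * Real.pi * K / k := by
  have hL : (0 : ℝ) < L := Nat.cast_pos.mpr (Nat.pos_of_ne_zero (NeZero.ne L))
  have hk : (0 : ℝ) < k := Nat.cast_pos.mpr (Nat.pos_of_ne_zero (NeZero.ne k))
  set κb : TorusSite 2 k := fun i => ((κ i : ℤ) : ZMod k) with hκb
  set b := cellOf L k x with hb
  -- integer shifts of the cell momentum representatives: `(κ̄ i).val = κ i + k * s i`
  have hs : ∀ i, ∃ s : ℤ, (((κb i).val : ℕ) : ℤ) = κ i + (k : ℤ) * s := by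
    intro i
    refine ⟨-(κ i / k), ?_⟩
    rw [hκb]
    simp only
    rw [ZMod.val_intCast]
    have := Int.mul_ediv_add_emod (κ i) k
    linarith
  choose s hs using hs
  rw [rig_phase_eq_exp, rig_cellPhase_eq_exp]
  -- the reduced phase difference
  set θ : ℝ := -(2 * Real.pi) * ∑ i : Fin 2, (κ i : ℝ) * (((x i).val : ℝ) / L - (((b i).val : ℕ) : ℝ) / k)
    with hθ
  set z : ℤ := -(∑ i : Fin 2, (t i * ((x i).val : ℤ) - s i * ((b i).val : ℤ))) with hz
  refine (rig_norm_exp_I_sub_exp_I_le _ _ z).trans ?_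
  have hident : -(2 * Real.pi / L) * ∑ i : Fin 2, ((k₀ i).val : ℝ) * ((x i).val : ℝ) -
      -(2 * Real.pi / k) * ∑ i : Fin 2, ((κb i).val : ℝ) * ((b i).val : ℝ) - 2 * Real.pi * (z : ℝ) = θ := by
    have hk₀r : ∀ i, ((k₀ i).val : ℝ) = (κ i : ℝ) + (L : ℝ) * (t i : ℝ) := fun i => by
      exact_mod_cast hrep i
    have hκbr : ∀ i, ((κb i).val : ℝ) = (κ i : ℝ) + (k : ℝ) * (s i : ℝ) := fun i => by
      exact_mod_cast hs i
    rw [hθ, hz]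
    simp only [Fin.sum_univ_two, hk₀r, hκbr]
    push_cast
    field_simp
    ring
  rw [hident, hθ, abs_mul, abs_neg, abs_of_pos Real.two_pi_pos]
  -- `|Σ κᵢ dᵢ| ≤ Σ |κᵢ| |dᵢ| ≤ K · (2/k)`
  have hd : ∀ i, |((x i).val : ℝ) / L - (((b i).val : ℕ) : ℝ) / k| ≤ 1 / k := by
    intro i
    have hbi : (b i) = cellIndex L k (x i) := by rw [hb]; rfl
    rw [hbi]
    obtain ⟨h0, h1⟩ := rig_cell_frac_bounds (k := k) (x i)
    rw [abs_of_nonneg h0]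
    exact h1
  have hsum : |∑ i : Fin 2, (κ i : ℝ) * (((x i).val : ℝ) / L - (((b i).val : ℕ) : ℝ) / k)| ≤ K * (2 / k) := by
    refine (Finset.abs_sum_le_sum_abs _ _).trans ?_
    have : ∀ i ∈ (Finset.univ : Finset (Fin 2)),
        |(κ i : ℝ) * (((x i).val : ℝ) / L - (((b i).val : ℕ) : ℝ) / k)| ≤ K * (1 / k) := by
      intro i _
      rw [abs_mul]
      refine mul_le_mul ?_ (hd i) (abs_nonneg _) (Nat.cast_nonneg K)
      exact_mod_cast hκK i
    refine (Finset.sum_le_sum this).trans (le_of_eq ?_)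
    rw [Finset.sum_const, Finset.card_univ, Fintype.card_fin]
    ring
  calc 2 * Real.pi * |∑ i : Fin 2, (κ i : ℝ) * (((x i).val : ℝ) / L - (((b i).val : ℕ) : ℝ) / k)|
      ≤ 2 * Real.pi * (K * (2 / k)) := mul_le_mul_of_nonneg_left hsum Real.two_pi_pos.le
    _ = 4 * Real.pi * K / k := by ring

/-- **The pair-momentum phase is nearly constant on cells, registered form** (all binders after the
colon): the statement of `rig_norm_phase_sub_cellPhase_le`. [folklore] -/
theorem rig_phase_cell_bound : ∀ (L : ℕ) [NeZero L] (k : ℕ) [NeZero k] (K : ℕ) (k₀ : TorusSite 2 L) (κ t : Fin 2 → ℤ), (∀ i, |κ i| ≤ K) → (∀ i, (((k₀ i).val : ℕ) : ℤ) = κ i + (L : ℤ) * t i) → ∀ x : TorusSite 2 L, ‖Complex.exp (-(2 * (Real.pi : ℂ) * Complex.I / (L : ℂ)) * ((∑ i : Fin 2, (k₀ i).val * (x i).val : ℕ) : ℂ)) - conj (torusChar (fun i => ((κ i : ℤ) : ZMod k)) (cellOf L k x))‖ ≤ 4 * Real.pi * K / k :=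
  fun L _ k _ K k₀ κ t hκK hrep x => rig_norm_phase_sub_cellPhase_le L k K k₀ κ t hκK hrep x

end Summit.HubbardSuperconductivity.HubbardSuperconductivity.Theorems.LowEnergyRigidity.Telescope
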